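import Literature.Probability.RandomPlanarGeometry.SLETraceKappaLimit
import Literature.Probability.RandomPlanarGeometry.CritPercSLESimplePathHolds
import Literature.Probability.RandomPlanarGeometry.DrivingFunctionMeasurable
import Literature.Probability.RandomPlanarGeometry.LoewnerDescriptionProofs
import HarnessLib

/-!
# `stub_sleInj` — well-separated times of the SLE(8/3) reference curve stay apart
(crux `PathUpgradeR`, stmt-CriticalPhenomena-18055, route `SAWReversalUpgrade`, line `bidir_windows`)

Landing target:
`Summits/CriticalPhenomena/SAWScalingLimit/Theorems/SAWReversalUpgradePathUpgradeRSLEInj.lean`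
(`--supports stmt-CriticalPhenomena-18055`; registered stub `stub_sleInj`).

The registered theorem `stub_sleInj` is a quantile lemma for the SLE(8/3) reference sample
`γ = sleTrace (8/3) ω` seen in a Dobrushin domain `E` through the boundary extension `ψ̄` of a
chordal uniformizer `ψ : ℍ ≃ E`: for every horizon `T`, separation `w > 0` and budget `β > 0`
there is a deterministic `μ > 0` such that the event "two times `s, t ≤ T + 1` with `|s - t| ≥ w`
have `dist (ψ̄ (γ s)) (ψ̄ (γ t)) < μ`" has `P'`-measure at most `β`.

Proof (sub-namespace `PathUpgradeRSLERegInj`, general `0 < κ ≤ 4`): a.s. the trace is simple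
(Rohde–Schramm Thm. 6.1, `ae_isSimpleTrace_sleTrace_of_le_four_apply`), so `r := ψ̄ ∘ γ` is
injective (`JordanDomain.injOn_boundaryExtension` on `{0 ≤ im}` ⊇ range of the trace) and
continuous; on the compact set of pairs `{(s, t) ∈ [0, R]² : w ≤ |s - t|}` the continuous positive
function `dist (r s) (r t)` is bounded below by some `μ(ω) > 0` (`exists_pos_le_dist`). The bad
events `B n` (threshold `1/(n+1)`) are preimages of open sets of paths under the Borel random
element `ω ↦ γ(ω) ∈ C([0, ∞), ℂ)` (`measurable_sleTracePath`), decrease in `n`, and have null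
intersection; continuity from above (`tendsto_measure_iInter_atTop`) gives `P' (B n) → 0`.
This imitates `PathUpgradeRRangeBound.exists_measure_tail_le`.
-/

noncomputable section

open scoped ENNReal NNReal Topology
open MeasureTheory Filter Set Metric TopologicalSpace
open Literature.Probability Literature.Probability.RandomPlanarGeometry
open UpperHalfPlane (upperHalfPlaneSet)

namespace Summit.CriticalPhenomena.SAWScalingLimit.Theorems

namespace PathUpgradeRSLERegInj

open scoped PathBorel

/-- Deterministic core: an injective continuous curve `r` on `[0, ∞)` separates well-separated
times of a compact window, i.e. some `μ > 0` has `μ ≤ dist (r s) (r t)` whenever `s, t ≤ R` and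
`w ≤ |s - t|` (`w > 0`); the continuous function `dist (r s) (r t)` attains a (positive) minimum
on the compact set of such pairs. [folklore] -/
theorem exists_pos_le_dist {X : Type*} [MetricSpace X] {r : ℝ≥0 → X} (hc : Continuous r)
    (hi : Function.Injective r) (R : ℝ≥0) {w : ℝ} (hw : 0 < w) :
    ∃ μ : ℝ, 0 < μ ∧ ∀ s t : ℝ≥0, s ≤ R → t ≤ R → w ≤ |(s : ℝ) - t| → μ ≤ dist (r s) (r t) := by
  set K : Set (ℝ≥0 × ℝ≥0) := {p | p.1 ≤ R ∧ p.2 ≤ R ∧ w ≤ |(p.1 : ℝ) - p.2|} with hK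
  have hKc : IsCompact K := by
    refine ((isCompact_Icc (a := (0 : ℝ≥0)) (b := R)).prod
      (isCompact_Icc (a := (0 : ℝ≥0)) (b := R))).of_isClosed_subset ?_ ?_
    · exact (isClosed_le continuous_fst continuous_const).inter
        ((isClosed_le continuous_snd continuous_const).inter
          (isClosed_le continuous_const (continuous_abs.comp
            ((NNReal.continuous_coe.comp continuous_fst).sub
              (NNReal.continuous_coe.comp continuous_snd)))))
    · rintro p ⟨h1, h2, -⟩
      exact ⟨⟨zero_le, h1⟩, ⟨zero_le, h2⟩⟩
  have hfc : Continuous fun p : ℝ≥0 × ℝ≥0 ↦ dist (r p.1) (r p.2) :=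
    (hc.comp continuous_fst).dist (hc.comp continuous_snd)
  rcases K.eq_empty_or_nonempty with hKe | hKne
  · refine ⟨1, one_pos, fun s t hs ht hst ↦ ?_⟩
    have hmem : (s, t) ∈ K := ⟨hs, ht, hst⟩
    rw [hKe] at hmem
    exact absurd hmem (notMem_empty _)
  · obtain ⟨p, hpK, hp⟩ := hKc.exists_isMinOn hKne hfc.continuousOn
    have hne : p.1 ≠ p.2 := by
      intro h
      have h' := hpK.2.2
      rw [h, sub_self, abs_zero] at h'
      exact absurd h' (not_le.2 hw)
    refine ⟨dist (r p.1) (r p.2), dist_pos.2 fun h ↦ hne (hi h), fun s t hs ht hst ↦ ?_⟩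
    exact (isMinOn_iff.1 hp) (s, t) ⟨hs, ht, hst⟩

/-- The SLE separation quantile, general `0 < κ ≤ 4`: for a conformal map `φ : ℍ → D` onto a
Dobrushin domain, a window `[0, R]`, a separation `w > 0` and a budget `β > 0`, some `n` has
`P' {∃ s t ≤ R, w ≤ |s - t|, dist (φ̄ (γ s)) (φ̄ (γ t)) < 1/(n+1)} ≤ β`. The events are preimages
of open path sets under the Borel random curve `ω ↦ γ(ω)` (`measurable_sleTracePath`, with the
continuous `φ̄ ∘ liftIm 0` in place of `φ̄`), decreasing in `n`, with null intersection since a.s.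
the trace is simple (`ae_isSimpleTrace_sleTrace_of_le_four_apply`) and `φ̄` is injective on the
closed half-plane (`JordanDomain.injOn_boundaryExtension`), whence `exists_pos_le_dist` applies
to `φ̄ ∘ γ`. [folklore] -/
theorem exists_measure_close_le {κ : ℝ≥0} (h0 : 0 < κ) (h4 : κ ≤ 4) {D : DobrushinDomain}
    (φ : ConformalEquiv upperHalfPlaneSet D.carrier) (R : ℝ≥0) {w : ℝ} (hw : 0 < w)
    {β : ℝ≥0∞} (hβ : 0 < β) :
    ∃ n : ℕ, Process.preWienerMeasure {ω | ∃ s t : ℝ≥0, s ≤ R ∧ t ≤ R ∧ w ≤ |(s : ℝ) - t| ∧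
      dist (φ.boundaryExtension (sleTrace κ ω s)) (φ.boundaryExtension (sleTrace κ ω t)) <
        1 / ((n : ℝ) + 1)} ≤ β := by
  haveI : IsProbabilityMeasure Process.preWienerMeasure := isProbabilityMeasure_preWienerMeasure'
  set Φ : ℂ → ℂ := fun z ↦ φ.boundaryExtension (Loewner.liftIm 0 z) with hΦ
  have hΦc : Continuous Φ := continuous_boundaryExtension_liftIm φ
  have hΦeq : ∀ (ω : ℝ≥0 → ℝ) (t : ℝ≥0),
      Φ (sleTrace κ ω t) = φ.boundaryExtension (sleTrace κ ω t) := fun ω t ↦ by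
    simp only [hΦ, Loewner.liftIm_of_le (sleTrace_im_nonneg κ ω t)]
  set U : ℕ → Set C(ℝ≥0, ℂ) := fun n ↦ {f | ∃ s t : ℝ≥0, s ≤ R ∧ t ≤ R ∧ w ≤ |(s : ℝ) - t| ∧
      dist (Φ (f s)) (Φ (f t)) < 1 / ((n : ℝ) + 1)} with hU
  have hUo : ∀ n, IsOpen (U n) := fun n ↦ by
    rw [isOpen_iff_forall_mem_open]
    rintro f ⟨s, t, hs, ht, hst, hd⟩
    exact ⟨{g | dist (Φ (g s)) (Φ (g t)) < 1 / ((n : ℝ) + 1)},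
      fun g hg ↦ ⟨s, t, hs, ht, hst, hg⟩,
      isOpen_lt ((hΦc.comp (continuous_eval_const s)).dist
        (hΦc.comp (continuous_eval_const t))) continuous_const, hd⟩
  set B : ℕ → Set (ℝ≥0 → ℝ) := fun n ↦
      (fun ω ↦ (⟨sleTrace κ ω, continuous_sleTrace κ ω⟩ : C(ℝ≥0, ℂ))) ⁻¹' U n with hB
  have hBmem : ∀ n ω, ω ∈ B n ↔ ∃ s t : ℝ≥0, s ≤ R ∧ t ≤ R ∧ w ≤ |(s : ℝ) - t| ∧
      dist (Φ (sleTrace κ ω s)) (Φ (sleTrace κ ω t)) < 1 / ((n : ℝ) + 1) := fun n ω ↦ Iff.rfl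
  have hBm : ∀ n, MeasurableSet (B n) := fun n ↦
    measurable_sleTracePath κ (hUo n).measurableSet
  have hanti : Antitone B := by
    intro n n' hnn' ω hω
    obtain ⟨s, t, hs, ht, hst, hd⟩ := (hBmem n' ω).1 hω
    refine (hBmem n ω).2 ⟨s, t, hs, ht, hst, hd.trans_le ?_⟩
    gcongr
  have hnull : Process.preWienerMeasure (⋂ n, B n) = 0 := by
    rw [measure_eq_zero_iff_ae_notMem]
    filter_upwards [ae_isSimpleTrace_sleTrace_of_le_four_apply h0 h4] with ω hω hmem
    have hinj : Function.Injective fun u ↦ Φ (sleTrace κ ω u) := by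
      intro u v huv
      have huv' : φ.boundaryExtension (sleTrace κ ω u) = φ.boundaryExtension (sleTrace κ ω v) := by
        rw [← hΦeq, ← hΦeq]; exact huv
      exact hω.1 (JordanDomain.injOn_boundaryExtension φ (sleTrace_im_nonneg κ ω u)
        (sleTrace_im_nonneg κ ω v) huv')
    obtain ⟨μ, hμ, hμle⟩ := exists_pos_le_dist (hΦc.comp (continuous_sleTrace κ ω)) hinj R hw
    obtain ⟨n, hn⟩ := exists_nat_one_div_lt hμ
    obtain ⟨s, t, hs, ht, hst, hd⟩ := (hBmem n ω).1 (mem_iInter.1 hmem n)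
    exact absurd ((hμle s t hs ht hst).trans_lt (hd.trans hn)) (lt_irrefl μ)
  have htend := tendsto_measure_iInter_atTop (μ := Process.preWienerMeasure)
    (fun n ↦ (hBm n).nullMeasurableSet) hanti ⟨0, measure_ne_top _ _⟩
  rw [hnull] at htend
  obtain ⟨n, hn⟩ := (htend.eventually_lt_const hβ).exists
  refine ⟨n, (measure_mono ?_).trans hn.le⟩
  rintro ω ⟨s, t, hs, ht, hst, hd⟩
  exact (hBmem n ω).2 ⟨s, t, hs, ht, hst, by rwa [hΦeq, hΦeq]⟩

end PathUpgradeRSLERegInj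

/-- **SLE separation quantile** (registered stub `stub_sleInj` of the line `bidir_windows`): for
the SLE(8/3) reference curve `γ` seen in the Dobrushin domain `E` through the boundary extension
`ψ̄` of a chordal uniformizer `ψ`, every horizon `T`, separation `w > 0` and budget `β > 0` admit
a deterministic `μ > 0` with
`P' {∃ s t ≤ T + 1, w ≤ |s - t|, dist (ψ̄ (γ s)) (ψ̄ (γ t)) < μ} ≤ β`
(a.s. `ψ̄ ∘ γ` is injective and continuous, `PathUpgradeRSLERegInj.exists_measure_close_le` at
`κ = 8/3 ≤ 4`, `μ := 1/(n+1)`). [folklore] -/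
theorem stub_sleInj : ∀ (E : Literature.Probability.RandomPlanarGeometry.DobrushinDomain) (ψ : Literature.Probability.RandomPlanarGeometry.ConformalEquiv UpperHalfPlane.upperHalfPlaneSet E.carrier), E.IsChordalUniformizing ψ → ∀ (T : NNReal) (w : ℝ), 0 < w → ∀ β : ENNReal, 0 < β → ∃ μ : ℝ, 0 < μ ∧ Literature.Probability.Process.preWienerMeasure {ω | ∃ s t : NNReal, (s : ℝ) ≤ T + 1 ∧ (t : ℝ) ≤ T + 1 ∧ w ≤ |(s : ℝ) - t| ∧ dist (ψ.boundaryExtension (Literature.Probability.RandomPlanarGeometry.sleTrace ((8:NNReal)/3) ω s)) (ψ.boundaryExtension (Literature.Probability.RandomPlanarGeometry.sleTrace ((8:NNReal)/3) ω t)) < μ} ≤ β := by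
  intro E ψ _ T w hw β hβ
  have hκ0 : (0 : ℝ≥0) < 8 / 3 := by positivity
  have hκ4 : (8 : ℝ≥0) / 3 ≤ 4 := by
    rw [div_le_iff₀ (by norm_num : (0 : ℝ≥0) < 3)]
    norm_num
  obtain ⟨n, hn⟩ := PathUpgradeRSLERegInj.exists_measure_close_le hκ0 hκ4 ψ (T + 1) hw hβ
  refine ⟨1 / ((n : ℝ) + 1), by positivity, (measure_mono ?_).trans hn⟩
  rintro ω ⟨s, t, hs, ht, hst, hd⟩
  exact ⟨s, t, by exact_mod_cast hs, by exact_mod_cast ht, hst, hd⟩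

end Summit.CriticalPhenomena.SAWScalingLimit.Theorems

end
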